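import Mathlib
import Summits.Ventures.HodgeRepro2.T5InducedLattice
import Summits.Ventures.HodgeRepro2.T5AdicCompletionEmbedding
import Summits.Ventures.HodgeRepro2.T5ValuedBallBasis

/-!
# The principal units of the induced lattice and the one-step approximations

Continuation of `T5InducedLattice` (`Kv ⊆ Lw` Mathlib's completions, `[Lw : Kv] = 2`, `σ ≠ 1`,
`θ ∈ O_Lw` non-zero anti-invariant, `lat θ γ` the induced lattice at level `γ`,
`κ = (v 2 · v 2 · v θ)⁻¹` the comparison constant):

* `principalUnits θ γ = {y ∈ Lwˣ | y − 1 ∈ lat θ γ}` («`1 + ϖ^n M`») is a subgroup of `Lwˣ` once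
  `γ κ ≤ 1` and `γ < 1` (`mul_sub_one_mem_lat`, `inv_sub_one_mem_lat`), `σ`-stable
  (`unitsAut_mem_principalUnits`), open (`isOpen_principalUnits`), inside the integer units and of
  FINITE INDEX there (`finiteIndex_principalUnits_subgroupOf`: open subgroup of a compact group);
* the ONE-STEP APPROXIMATIONS behind `Ĥ⁰(V) = 0` and `Ĥ⁻¹(V) = 0` (`exists_normConj_approx`,
  `exists_diff_approx`): a `σ`-fixed `y ∈ 1 + lat γ` is `N(c) · r` with `c = 1 + alg α (1 + θ)`,
  `c ∈ 1 + lat γ`, and `r` `σ`-fixed in `1 + lat (γ (γ κ κ))`; a norm-one `y ∈ 1 + lat γ` is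
  `(c / σ c) · r` with `r` of norm one in `1 + lat (γ (γ κ κ))` — the level gains a factor `γ κ κ < 1`;
* `eq_zero_of_forall_val_le_mul_pow`: `v x ≤ γ₀ ρ^n` for every `n` with `ρ < 1` forces `x = 0`
  (the limit step of the Cantor argument of `T5InducedLatticeCohomology`).

This is the body of Serre, *Local Class Field Theory* (Cassels–Fröhlich Ch. VI) §1.4 Prop. 3 («there exists an open subgroup `V` of `U_L`,
stable under `G`, with `Ĥ^q(G, V) = 0`»), for `G` of order `2`, at EVERY residue characteristic
(`2` need not be a unit: the induced lattice `M` replaces the filtration by principal units).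

Declaration per README §8(d): «uses an L-value-free non-vanishing device: NO».
-/

namespace Summit.Ventures.HodgeRepro2.T5InducedLatticeUnits

open IsDedekindDomain HeightOneSpectrum WithZero T5InducedLattice

variable {K : Type*} [Field K] [NumberField K] (v : HeightOneSpectrum (NumberField.RingOfIntegers K))
  {L : Type*} [Field L] [NumberField L] [Algebra K L]
  (w : HeightOneSpectrum (NumberField.RingOfIntegers L)) [w.asIdeal.LiesOver v.asIdeal]
  (σ : Gal(adicCompletion L w/adicCompletion K v))

section ValueGroup

/-- A geometric sequence `γ₀ ρ^n` with `ρ < 1` in `ℤᵐ⁰` eventually lies below every `exp (−(j+1))`: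
an element whose valuation is `≤ γ₀ ρ^n` for every `n` is `0`. -/
theorem eq_zero_of_forall_val_le_mul_pow {x : adicCompletion L w} {γ₀ ρ : WithZero (Multiplicative ℤ)}
    (hρ : ρ < 1) (h : ∀ n : ℕ, Valued.v x ≤ γ₀ * ρ ^ n) : x = 0 := by
  by_contra hx
  have hne : Valued.v x ≠ 0 := (Valuation.ne_zero_iff _).mpr hx
  obtain ⟨k, hk⟩ : ∃ k : ℤ, Valued.v x = exp k := ⟨_, (exp_log hne).symm⟩
  have hγ0 : γ₀ ≠ 0 := by
    intro h0
    have := h 0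
    rw [h0, zero_mul] at this
    exact hne (le_antisymm this zero_le)
  obtain ⟨k₀, hk₀⟩ : ∃ k₀ : ℤ, γ₀ = exp k₀ := ⟨_, (exp_log hγ0).symm⟩
  rcases eq_or_ne ρ 0 with hρ0 | hρ0
  · have := h 1
    rw [hρ0, pow_one, mul_zero] at this
    exact hne (le_antisymm this zero_le)
  obtain ⟨m, hm⟩ : ∃ m : ℤ, ρ = exp m := ⟨_, (exp_log hρ0).symm⟩
  have hm0 : m < 0 := by
    rw [hm, ← exp_zero, exp_lt_exp] at hρ; exact hρ
  -- choose `n` with `k₀ + n m < k`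
  set n : ℕ := (k₀ - k + 1).toNat with hn
  have hn' : (k₀ - k + 1 : ℤ) ≤ n := Int.self_le_toNat _
  have := h n
  rw [hk, hk₀, hm, ← exp_nsmul, ← exp_add, exp_le_exp, nsmul_eq_mul] at this
  nlinarith

end ValueGroup

section Units

variable (h2 : Module.finrank (adicCompletion K v) (adicCompletion L w) = 2) (hσ : σ ≠ 1)
  {θ : adicCompletion L w} (hθ : σ θ = -θ) (hθ0 : θ ≠ 0) (hθ1 : Valued.v θ ≤ 1)

/-- `v (1 + z) = 1` for `z ∈ lat θ γ`, `γ < 1`. -/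
theorem val_one_add_eq_one_of_mem_lat {γ : WithZero (Multiplicative ℤ)} (hγ1 : γ < 1)
    {z : adicCompletion L w} (hz : z ∈ lat v w θ γ) (hθ1 : Valued.v θ ≤ 1) :
    Valued.v (1 + z) = 1 :=
  Valuation.map_one_add_of_lt _ (lt_of_le_of_lt (val_le_of_mem_lat v w hθ1 hz) hγ1)

/-- `v y = 1` when `y − 1 ∈ lat θ γ`, `γ < 1`. -/
theorem val_eq_one_of_sub_one_mem_lat {γ : WithZero (Multiplicative ℤ)} (hγ1 : γ < 1)
    {y : adicCompletion L w} (hy : y - 1 ∈ lat v w θ γ) (hθ1 : Valued.v θ ≤ 1) :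
    Valued.v y = 1 := by
  have := val_one_add_eq_one_of_mem_lat v w hγ1 hy hθ1
  rwa [add_sub_cancel] at this

include h2 hσ hθ hθ0 hθ1 in
/-- `γ κ ≤ 1` ⇒ `(1 + lat γ) · (1 + lat γ) ⊆ 1 + lat γ`. -/
theorem mul_sub_one_mem_lat {γ : WithZero (Multiplicative ℤ)} (hγ : γ * kappa v w θ ≤ 1)
    {y y' : adicCompletion L w} (hy : y - 1 ∈ lat v w θ γ) (hy' : y' - 1 ∈ lat v w θ γ) :
    y * y' - 1 ∈ lat v w θ γ := by
  have e : y * y' - 1 = (y - 1) + (y' - 1) + (y - 1) * (y' - 1) := by ring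
  rw [e]
  refine add_mem_lat v w (add_mem_lat v w hy hy') (lat_mono v w ?_ (mul_mem_lat v w σ h2 hσ hθ hθ0 hθ1 hy hy'))
  calc γ * γ * kappa v w θ = γ * (γ * kappa v w θ) := mul_assoc _ _ _
    _ ≤ γ * 1 := mul_le_mul_right hγ γ
    _ = γ := mul_one γ

include h2 hσ hθ hθ0 hθ1 in
/-- `γ κ ≤ 1`, `γ < 1` ⇒ `(1 + lat γ)⁻¹ ⊆ 1 + lat γ`. -/
theorem inv_sub_one_mem_lat {γ : WithZero (Multiplicative ℤ)} (hγ : γ * kappa v w θ ≤ 1) (hγ1 : γ < 1)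
    {y : adicCompletion L w} (hy : y - 1 ∈ lat v w θ γ) : y⁻¹ - 1 ∈ lat v w θ γ := by
  have hy1 : Valued.v y = 1 := val_eq_one_of_sub_one_mem_lat v w hγ1 hy hθ1
  have hy0 : y ≠ 0 := by
    intro h0; rw [h0, map_zero] at hy1; exact zero_ne_one hy1
  have e : y⁻¹ - 1 = -(y - 1) + (y - 1) * (y - 1) * y⁻¹ := by
    field_simp
    ring
  rw [e]
  refine add_mem_lat v w (neg_mem_lat v w hy)
    (lat_mono v w ?_ (mem_lat_of_val_le v w σ h2 hσ hθ hθ0 hθ1 (γ := γ * γ) ?_))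
  · calc γ * γ * kappa v w θ = γ * (γ * kappa v w θ) := mul_assoc _ _ _
      _ ≤ γ * 1 := mul_le_mul_right hγ γ
      _ = γ := mul_one γ
  · rw [map_mul, map_mul, map_inv₀, hy1, inv_one, mul_one]
    exact mul_le_mul' (val_le_of_mem_lat v w hθ1 hy) (val_le_of_mem_lat v w hθ1 hy)

variable {γ : WithZero (Multiplicative ℤ)}

/-- THE PRINCIPAL UNITS OF THE INDUCED LATTICE: `{y ∈ Lwˣ | y − 1 ∈ lat θ γ}` («`1 + ϖ^n M`»), a
subgroup once `γ κ ≤ 1` and `γ < 1`. -/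
def principalUnits (hγ : γ * kappa v w θ ≤ 1) (hγ1 : γ < 1) : Subgroup (adicCompletion L w)ˣ where
  carrier := {y | (y : adicCompletion L w) - 1 ∈ lat v w θ γ}
  one_mem' := by
    simp only [Set.mem_setOf_eq, Units.val_one, sub_self]
    exact zero_mem_lat v w θ γ
  mul_mem' := fun {y y'} hy hy' => by
    simp only [Set.mem_setOf_eq, Units.val_mul] at hy hy' ⊢
    exact mul_sub_one_mem_lat v w σ h2 hσ hθ hθ0 hθ1 hγ hy hy'
  inv_mem' := fun {y} hy => by
    simp only [Set.mem_setOf_eq, Units.val_inv_eq_inv_val] at hy ⊢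
    exact inv_sub_one_mem_lat v w σ h2 hσ hθ hθ0 hθ1 hγ hγ1 hy

variable (hγ : γ * kappa v w θ ≤ 1) (hγ1 : γ < 1)

include h2 hσ hθ hθ0 hθ1 in
/-- Membership in `principalUnits`. -/
theorem mem_principalUnits_iff {y : (adicCompletion L w)ˣ} :
    y ∈ principalUnits v w σ h2 hσ hθ hθ0 hθ1 hγ hγ1 ↔ (y : adicCompletion L w) - 1 ∈ lat v w θ γ :=
  Iff.rfl

/-- The automorphism `σ` on `Lwˣ`. -/
noncomputable def unitsAut : (adicCompletion L w)ˣ →* (adicCompletion L w)ˣ :=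
  Units.map (σ : adicCompletion L w →* adicCompletion L w)

/-- `unitsAut` on an element. -/
@[simp] theorem coe_unitsAut (y : (adicCompletion L w)ˣ) :
    ((unitsAut v w σ y : (adicCompletion L w)ˣ) : adicCompletion L w) = σ y := rfl

include h2 hσ in
/-- `unitsAut` is an involution. -/
theorem unitsAut_unitsAut (y : (adicCompletion L w)ˣ) : unitsAut v w σ (unitsAut v w σ y) = y := by
  haveI : FiniteDimensional (adicCompletion K v) (adicCompletion L w) :=
    FiniteDimensional.of_finrank_eq_succ h2
  apply Units.ext
  rw [coe_unitsAut, coe_unitsAut]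
  exact T5QuadraticAutomorphism.apply_apply h2 σ hσ _

include h2 hσ hθ hθ0 hθ1 in
/-- `principalUnits` is `σ`-stable. -/
theorem unitsAut_mem_principalUnits {y : (adicCompletion L w)ˣ}
    (hy : y ∈ principalUnits v w σ h2 hσ hθ hθ0 hθ1 hγ hγ1) :
    unitsAut v w σ y ∈ principalUnits v w σ h2 hσ hθ hθ0 hθ1 hγ hγ1 := by
  rw [mem_principalUnits_iff] at hy ⊢
  rw [coe_unitsAut]
  have : σ (y : adicCompletion L w) - 1 = σ ((y : adicCompletion L w) - 1) := by
    rw [map_sub, map_one]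
  rw [this]
  exact algEquiv_mem_lat v w σ hθ hy

include h2 hσ hθ hθ0 hθ1 in
/-- `principalUnits ≤ adicIntegerUnits`. -/
theorem principalUnits_le_adicIntegerUnits :
    principalUnits v w σ h2 hσ hθ hθ0 hθ1 hγ hγ1 ≤ T5AdicCompletionEmbedding.adicIntegerUnits w := by
  intro y hy
  rw [mem_principalUnits_iff] at hy
  have hy1 : Valued.v (y : adicCompletion L w) = 1 := val_eq_one_of_sub_one_mem_lat v w hγ1 hy hθ1
  rw [T5AdicCompletionEmbedding.mem_adicIntegerUnits_iff, mem_adicCompletionIntegers,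
    mem_adicCompletionIntegers, Units.val_inv_eq_inv_val, map_inv₀, hy1, inv_one]
  exact ⟨le_rfl, le_rfl⟩

include h2 hσ hθ hθ0 hθ1 in
/-- `lat θ γ` is open (it contains the closed ball of radius `γ / κ`, a neighbourhood of `0`). -/
theorem isOpen_lat (hγ0 : γ ≠ 0) : IsOpen (lat v w θ γ) := by
  rw [← coe_latAddSubgroup]
  apply AddSubgroup.isOpen_of_mem_nhds (g := 0)
  have hκ0 : kappa v w θ ≠ 0 := kappa_ne_zero v w hθ0 hθ1
  have hne : γ * (kappa v w θ)⁻¹ ≠ 0 := mul_ne_zero hγ0 (inv_ne_zero hκ0)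
  refine Filter.mem_of_superset (T5ValuedBallBasis.ball_mem_nhds_zero (log (γ * (kappa v w θ)⁻¹))) ?_
  intro x hx
  simp only [Set.mem_setOf_eq] at hx
  rw [exp_log hne] at hx
  have := mem_lat_of_val_le v w σ h2 hσ hθ hθ0 hθ1 hx
  rwa [inv_mul_cancel_right₀ hκ0] at this

include h2 hσ hθ hθ0 hθ1 in
/-- `principalUnits` is open in `Lwˣ`. -/
theorem isOpen_principalUnits (hγ0 : γ ≠ 0) :
    IsOpen ((principalUnits v w σ h2 hσ hθ hθ0 hθ1 hγ hγ1 : Subgroup (adicCompletion L w)ˣ) :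
      Set (adicCompletion L w)ˣ) := by
  have : ((principalUnits v w σ h2 hσ hθ hθ0 hθ1 hγ hγ1 : Subgroup (adicCompletion L w)ˣ) :
      Set (adicCompletion L w)ˣ) =
      (Units.val : (adicCompletion L w)ˣ → adicCompletion L w) ⁻¹'
        ((fun y : adicCompletion L w => y - 1) ⁻¹' lat v w θ γ) := rfl
  rw [this]
  exact (isOpen_lat v w σ h2 hσ hθ hθ0 hθ1 hγ0).preimage (continuous_id.sub continuous_const)
    |>.preimage Units.continuous_val

include h2 hσ hθ hθ0 hθ1 in
/-- `principalUnits` has finite index in the (compact) integer units. -/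
theorem finiteIndex_principalUnits_subgroupOf (hγ0 : γ ≠ 0) :
    ((principalUnits v w σ h2 hσ hθ hθ0 hθ1 hγ hγ1).subgroupOf
      (T5AdicCompletionEmbedding.adicIntegerUnits w)).FiniteIndex := by
  haveI := T5AdicCompletionEmbedding.compactSpace_adicIntegerUnits w
  have hopen : IsOpen (((principalUnits v w σ h2 hσ hθ hθ0 hθ1 hγ hγ1).subgroupOf
      (T5AdicCompletionEmbedding.adicIntegerUnits w) :
        Subgroup (T5AdicCompletionEmbedding.adicIntegerUnits w)) :
        Set (T5AdicCompletionEmbedding.adicIntegerUnits w)) := by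
    rw [Subgroup.subgroupOf, Subgroup.coe_comap, Subgroup.coe_subtype]
    exact (isOpen_principalUnits v w σ h2 hσ hθ hθ0 hθ1 hγ hγ1 hγ0).preimage continuous_subtype_val
  haveI : Finite ((T5AdicCompletionEmbedding.adicIntegerUnits w) ⧸
      (principalUnits v w σ h2 hσ hθ hθ0 hθ1 hγ hγ1).subgroupOf
        (T5AdicCompletionEmbedding.adicIntegerUnits w)) :=
    Subgroup.quotient_finite_of_isOpen _ hopen
  exact Subgroup.finiteIndex_of_finite_quotient

end Units

section Approximation

variable (h2 : Module.finrank (adicCompletion K v) (adicCompletion L w) = 2) (hσ : σ ≠ 1)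
  {θ : adicCompletion L w} (hθ : σ θ = -θ) (hθ0 : θ ≠ 0) (hθ1 : Valued.v θ ≤ 1)

include h2 hσ in
/-- `σ ∘ σ = id`. -/
theorem algEquiv_apply_apply (x : adicCompletion L w) : σ (σ x) = x := by
  haveI : FiniteDimensional (adicCompletion K v) (adicCompletion L w) :=
    FiniteDimensional.of_finrank_eq_succ h2
  exact T5QuadraticAutomorphism.apply_apply h2 σ hσ x

include hθ0 hθ1 in
/-- `v (alg 2)⁻¹ ≤ κ`. -/
theorem inv_val_two_le_kappa :
    (Valued.v (algebraMap (adicCompletion K v) (adicCompletion L w) (2 : adicCompletion K v)))⁻¹ ≤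
      kappa v w θ := by
  rw [kappa, mul_inv, mul_inv]
  have h2ne := val_two_ne_zero v w
  have hθne : Valued.v θ ≠ 0 := (Valuation.ne_zero_iff _).mpr hθ0
  have hinv2 := one_le_inv_of_le_one (val_two_le_one v w) h2ne
  have hinvθ := one_le_inv_of_le_one hθ1 hθne
  calc (Valued.v (algebraMap (adicCompletion K v) (adicCompletion L w) (2 : adicCompletion K v)))⁻¹
      = (Valued.v (algebraMap (adicCompletion K v) (adicCompletion L w) (2 : adicCompletion K v)))⁻¹ * 1 * 1 := by
        simp
    _ ≤ _ := mul_le_mul' (mul_le_mul' le_rfl hinv2) hinvθ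

include h2 hσ hθ hθ0 hθ1 in
/-- ONE STEP OF `Ĥ⁰(V) = 0`: a `σ`-fixed `y = 1 + z` with `z ∈ lat γ` (`γ < 1`) is `N(c) · r` with
`c = 1 + alg α (1 + θ) ∈ 1 + lat γ` and `r` `σ`-fixed in `1 + lat (γ (γ κ κ))`. -/
theorem exists_normConj_approx {γ : WithZero (Multiplicative ℤ)} (hγ1 : γ < 1)
    {y : adicCompletion L w} (hy : y - 1 ∈ lat v w θ γ) (hfix : σ y = y) :
    ∃ c : adicCompletion L w, c - 1 ∈ lat v w θ γ ∧
      σ (y / (c * σ c)) = y / (c * σ c) ∧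
      y / (c * σ c) - 1 ∈ lat v w θ (γ * (γ * kappa v w θ * kappa v w θ)) := by
  have hfix' : σ (y - 1) = y - 1 := by rw [map_sub, map_one, hfix]
  obtain ⟨α, hα, hz⟩ := exists_eq_of_mem_lat_of_fixed v w σ hθ hθ0 hy hfix'
  set A := algebraMap (adicCompletion K v) (adicCompletion L w) α with hA
  have hσA : σ A = A := σ.commutes α
  set c : adicCompletion L w := 1 + A * (1 + θ) with hc
  have hcmem : c - 1 ∈ lat v w θ γ := by
    rw [hc, add_sub_cancel_left]
    exact ⟨α, 0, hα, by simp, by simp [hA]⟩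
  have hσc : σ c = 1 + A * (1 - θ) := by
    rw [hc, map_add, map_one, map_mul, hσA, map_add, map_one, hθ, sub_eq_add_neg]
  -- `N c = y + A² (1 + θ)(1 − θ)`
  have hN : c * σ c = y + A * A * ((1 + θ) * (1 - θ)) := by
    rw [hσc, hc]
    have : y = 1 + (A * (1 + θ) + A * (1 - θ)) := by rw [← hz]; ring
    rw [this]; ring
  have hcv : Valued.v c = 1 := by
    rw [hc]
    apply Valuation.map_one_add_of_lt
    have : A * (1 + θ) ∈ lat v w θ γ := ⟨α, 0, hα, by simp, by simp [hA]⟩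
    exact lt_of_le_of_lt (val_le_of_mem_lat v w hθ1 this) hγ1
  have hσcv : Valued.v (σ c) = 1 := by
    rw [T5AdicCompletionGaloisInvariance.val_algEquiv_apply v w σ, hcv]
  have hNv : Valued.v (c * σ c) = 1 := by rw [map_mul, hcv, hσcv, mul_one]
  have hN0 : c * σ c ≠ 0 := by
    intro h0; rw [h0, map_zero] at hNv; exact zero_ne_one hNv
  refine ⟨c, hcmem, ?_, ?_⟩
  · rw [map_div₀, hfix, map_mul, algEquiv_apply_apply v w σ h2 hσ, mul_comm]
  · have e : y / (c * σ c) - 1 = -(A * A * ((1 + θ) * (1 - θ))) / (c * σ c) := by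
      rw [div_sub_one hN0, hN]
      ring
    rw [e]
    refine lat_mono v w ?_ (mem_lat_of_val_le v w σ h2 hσ hθ hθ0 hθ1 (γ := γ * γ) ?_)
    · rw [mul_assoc, mul_assoc]
      refine mul_le_mul_right (mul_le_mul_right ?_ γ) γ
      exact le_mul_of_one_le_right' (one_le_kappa v w hθ0 hθ1)
    · rw [map_div₀, hNv, div_one, Valuation.map_neg, map_mul, map_mul, map_mul]
      have h1 : Valued.v (1 + θ : adicCompletion L w) ≤ 1 :=
        (Valuation.map_add _ _ _).trans (max_le (by simp) hθ1)
      have h2' : Valued.v (1 - θ : adicCompletion L w) ≤ 1 :=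
        (Valuation.map_sub _ _ _).trans (max_le (by simp) hθ1)
      calc Valued.v A * Valued.v A * (Valued.v (1 + θ) * Valued.v (1 - θ))
          ≤ γ * γ * (1 * 1) := mul_le_mul' (mul_le_mul' hα hα) (mul_le_mul' h1 h2')
        _ = γ * γ := by rw [mul_one, mul_one]

include h2 hσ hθ hθ0 hθ1 in
/-- ONE STEP OF `Ĥ⁻¹(V) = 0`: a norm-one `y = 1 + z` with `z ∈ lat γ` (`γ < 1`) is `(c / σ c) · r`
with `c = 1 + alg α (1 + θ) ∈ 1 + lat γ` and `r` of norm one in `1 + lat (γ (γ κ κ))`. -/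
theorem exists_diff_approx {γ : WithZero (Multiplicative ℤ)} (hγ1 : γ < 1)
    {y : adicCompletion L w} (hy : y - 1 ∈ lat v w θ γ) (hN : y * σ y = 1) :
    ∃ c : adicCompletion L w, c - 1 ∈ lat v w θ γ ∧
      (y * σ c / c) * σ (y * σ c / c) = 1 ∧
      y * σ c / c - 1 ∈ lat v w θ (γ * (γ * kappa v w θ * kappa v w θ)) := by
  obtain ⟨α, β, hα, hβ, hz⟩ := hy
  set A := algebraMap (adicCompletion K v) (adicCompletion L w) α with hA
  set B := algebraMap (adicCompletion K v) (adicCompletion L w) β with hB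
  set two := algebraMap (adicCompletion K v) (adicCompletion L w) (2 : adicCompletion K v) with htwo
  have hσA : σ A = A := σ.commutes α
  have hσB : σ B = B := σ.commutes β
  set z : adicCompletion L w := y - 1 with hzdef
  have hzv : Valued.v z ≤ γ := val_le_of_mem_lat v w hθ1 ⟨α, β, hα, hβ, hz⟩
  have hσz : σ z = A * (1 - θ) + B * (1 + θ) := by
    rw [hz, map_add, map_mul, map_mul, hσA, hσB, map_add, map_one, hθ, map_sub, map_one, hθ]
    ring
  -- `N y = 1` ⇒ `(A + B) · 2 = − z σ z`
  have htrace : (A + B) * two = -(z * σ z) := by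
    have hy' : y = 1 + z := by rw [hzdef, add_sub_cancel]
    have hσy : σ y = 1 + σ z := by rw [hy', map_add, map_one]
    have hN' : (1 + z) * (1 + σ z) = 1 := by rw [← hy', ← hσy]; exact hN
    have : z + σ z + z * σ z = 0 := by linear_combination hN'
    rw [hσz, hz] at this
    rw [hσz, hz, htwo, map_ofNat]
    linear_combination this
  have h2ne := val_two_ne_zero v w
  have hAB : Valued.v (A + B) ≤ γ * γ * (Valued.v two)⁻¹ := by
    rw [le_mul_inv_iff₀ (lt_of_le_of_ne zero_le h2ne.symm), ← map_mul, htrace, Valuation.map_neg,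
      map_mul, T5AdicCompletionGaloisInvariance.val_algEquiv_apply v w σ]
    exact mul_le_mul' hzv hzv
  set c : adicCompletion L w := 1 + A * (1 + θ) with hc
  have hcmem : c - 1 ∈ lat v w θ γ := by
    rw [hc, add_sub_cancel_left]
    exact ⟨α, 0, hα, by simp, by simp [hA]⟩
  have hσc : σ c = 1 + A * (1 - θ) := by
    rw [hc, map_add, map_one, map_mul, hσA, map_add, map_one, hθ, sub_eq_add_neg]
  have hcv : Valued.v c = 1 := by
    rw [hc]
    apply Valuation.map_one_add_of_lt
    have : A * (1 + θ) ∈ lat v w θ γ := ⟨α, 0, hα, by simp, by simp [hA]⟩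
    exact lt_of_le_of_lt (val_le_of_mem_lat v w hθ1 this) hγ1
  have hc0 : c ≠ 0 := by
    intro h0; rw [h0, map_zero] at hcv; exact zero_ne_one hcv
  have hσcv : Valued.v (σ c) = 1 := by
    rw [T5AdicCompletionGaloisInvariance.val_algEquiv_apply v w σ, hcv]
  have hσc0 : σ c ≠ 0 := by
    intro h0; rw [h0, map_zero] at hσcv; exact zero_ne_one hσcv
  -- `y σ c − c = (A + B)(1 − θ) + z A (1 − θ)`
  have hdiff : y * σ c - c = (A + B) * (1 - θ) + z * (A * (1 - θ)) := by
    have hy' : y = 1 + z := by rw [hzdef, add_sub_cancel]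
    rw [hσc, hc, hy', hz]
    ring
  have hdiffv : Valued.v (y * σ c - c) ≤ γ * γ * (Valued.v two)⁻¹ := by
    rw [hdiff]
    have h1 : Valued.v (1 - θ : adicCompletion L w) ≤ 1 :=
      (Valuation.map_sub _ _ _).trans (max_le (by simp) hθ1)
    have hinv2 := one_le_inv_of_le_one (val_two_le_one v w) h2ne
    refine (Valuation.map_add _ _ _).trans (max_le ?_ ?_)
    · rw [map_mul]
      calc Valued.v (A + B) * Valued.v (1 - θ) ≤ γ * γ * (Valued.v two)⁻¹ * 1 := mul_le_mul' hAB h1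
        _ = γ * γ * (Valued.v two)⁻¹ := mul_one _
    · rw [map_mul, map_mul]
      calc Valued.v z * (Valued.v A * Valued.v (1 - θ)) ≤ γ * (γ * 1) := mul_le_mul' hzv (mul_le_mul' hα h1)
        _ = γ * γ * 1 := by rw [mul_one, mul_one]
        _ ≤ γ * γ * (Valued.v two)⁻¹ := mul_le_mul_right hinv2 _
  have hcσ0 : c * σ c ≠ 0 := mul_ne_zero hc0 hσc0
  refine ⟨c, hcmem, ?_, ?_⟩
  · rw [map_div₀, map_mul, algEquiv_apply_apply v w σ h2 hσ, div_mul_div_comm, mul_mul_mul_comm, hN,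
      one_mul, mul_comm (σ c) c, div_self hcσ0]
  · have e : y * σ c / c - 1 = (y * σ c - c) / c := (div_sub_one hc0).trans rfl
    rw [e]
    refine lat_mono v w ?_ (mem_lat_of_val_le v w σ h2 hσ hθ hθ0 hθ1 (γ := γ * γ * (Valued.v two)⁻¹) ?_)
    · calc γ * γ * (Valued.v two)⁻¹ * kappa v w θ = γ * (γ * ((Valued.v two)⁻¹ * kappa v w θ)) := by
            ac_rfl
        _ ≤ γ * (γ * (kappa v w θ * kappa v w θ)) := by
            refine mul_le_mul_right (mul_le_mul_right ?_ γ) γ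
            exact mul_le_mul_left (inv_val_two_le_kappa v w hθ0 hθ1) _
        _ = γ * (γ * kappa v w θ * kappa v w θ) := by rw [mul_assoc γ (kappa v w θ)]
    · rw [map_div₀, hcv, div_one]
      exact hdiffv

end Approximation

end Summit.Ventures.HodgeRepro2.T5InducedLatticeUnits
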